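import Mathlib.Topology.MetricSpace.Basic
import Mathlib.Topology.MetricSpace.Lipschitz
import Mathlib.Topology.MetricSpace.HausdorffDistance
import Mathlib.Topology.UniformSpace.HeineCantor
import Mathlib.Topology.Inseparable
import Mathlib.MeasureTheory.Constructions.BorelSpace.Basic
import Mathlib.MeasureTheory.Measure.Tight
import Mathlib.MeasureTheory.Function.ConvergenceInDistribution
import Mathlib.Topology.ContinuousMap.Bounded.Basic
import Mathlib.Topology.MetricSpace.Polish
import Mathlib.Topology.MetricSpace.Cauchy
import Mathlib.Topology.ContinuousMap.SecondCountableSpace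
import Mathlib.Analysis.SpecificLimits.Basic
import Literature.Probability.RandomPlanarGeometry.Curve
import HarnessLib

-- provenance: harness21/H21/H21/Prelude/Stoch/CurveSpace.lean @ 85125d2 (interim HEAD d8f2665); M5 mechanical rewrite
/-!
# The space of curves modulo reparametrisation

Trunk `Stoch`, prelude item `CurveSpace` (notion `curve_space_mod_reparam`, part 2: the quotient).

The file `Literature.Prelude.Stoch.Curve` equips parametrised curves `Curve E` (continuous maps
`unitInterval → E`) with the reparametrisation pseudo-metric
`dist γ₁ γ₂ = inf_φ sup_t dist (γ₁ t) (γ₂ (φ t))`. Here we pass to the metric quotient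
`CurveClass E := SeparationQuotient (Curve E)`, the space of curves modulo increasing
reparametrisation, which Mathlib automatically makes a metric space
(`SeparationQuotient.instMetricSpace`). We register its Borel σ-algebra, descend the basic
functionals (endpoints, trace, push-forward along continuous maps) to the quotient with the
invariance proofs supplied, define the events used by the statement files (hitting `A` before `B`,
staying inside a set, simplicity), and prove the topological facts from the literature
(completeness, separability, Polishness), which are also registered as instances.

Finally, two law-level combinators used by all scaling-limit statements of the trunk are defined
for a general topological target `X`: tightness of a family of laws indexed by the mesh
`δ ∈ (0,1]` (`IsTightLaws`, via Mathlib's `IsTightMeasureSet`) and convergence in law of random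
variables as the mesh `δ → 0⁺` in portmanteau form (`TendstoLaw`), linked to Mathlib's
`MeasureTheory.TendstoInDistribution`.

Sources: M. Aizenman, A. Burchard, *Hölder regularity and dimension bounds for random curves*,
Duke Math. J. 99 (1999), §2.1; P. Billingsley, *Convergence of probability measures* (2nd ed.,
1999), §1–§2 (weak convergence, tightness).

## Design / Mathlib

* `CurveClass E` is an `abbrev` for `SeparationQuotient (Curve E)`, so all of Mathlib's
  `SeparationQuotient` API (`mk`, `lift`, `continuous_mk`, `surjective_mk`, the metric) applies.
* The quotient itself only needs `[PseudoMetricSpace E]`; the functionals `source`, `target`,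
  `range` need `[MetricSpace E]` (distance zero must imply equality of endpoints), as do the events.
  `CurveClass.map f` for a merely continuous `f : C(E, F)` is well defined already for
  pseudo-metric `E`, `F`: invariance is proved from uniform continuity of `f` on the compact set
  `range γ₁ ∪ range γ₂` (Heine–Cantor, `IsCompact.uniformContinuousOn_of_continuous`).
* `completeSpace`, `secondCountableTopology`, `polishSpace` are named facts (`def … : Prop`)
  discharged by `completeSpace_holds`, `secondCountableTopology_holds`, `polishSpace_holds`; the
  underlying results are moreover registered as instances on `Curve E` and `CurveClass E`
  (`Curve.instCompleteSpace`, `Curve.instSeparableSpace`, `CurveClass.instCompleteSpace`,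
  `CurveClass.instSecondCountableTopology`, `CurveClass.instPolishSpace`). Completeness is the
  standard argument (Aizenman–Burchard 1999, §2.a p. 12 and §4 p. 22: "standard arguments, such as
  used for `C([0,1], ℝ^d)`"): along a sequence with `dist (u n) (u (n+1)) < 2⁻ⁿ` choose
  reparametrisations realising these bounds, telescope them so that the reparametrised curves form
  a Cauchy sequence for the sup distance of `C(unitInterval, E)` (complete), and observe that the
  reparametrisation distance to the uniform limit is at most the sup distance. Separability:
  `CurveClass E` is a continuous image of the separable space `C(unitInterval, E)`
  (`ContinuousMap.instSeparableSpace`).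
* `TendstoLaw` needs no probability or measurability instances; the lemma
  `tendstoLaw_iff_tendstoInDistribution` identifies it with Mathlib's `TendstoInDistribution`
  along the filter `𝓝[>] 0` under the usual hypotheses.
-/

open Set Filter Topology MeasureTheory
open scoped BoundedContinuousFunction

namespace Literature.Probability.RandomPlanarGeometry

variable {E F : Type*}

namespace Curve

section PseudoMetric

variable [PseudoMetricSpace E] [PseudoMetricSpace F]

/-- If two curves are at distance `< c`, some reparametrisation of the second is at sup distance
`< c` from the first (Aizenman–Burchard 1999, §2.1, eq. (2.2)). [cite: AizenmanBurchard1999, §2.1  eq. (2.2] -/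
lemma exists_dist_reparam_lt {γ₁ γ₂ : Curve E} {c : ℝ} (h : dist γ₁ γ₂ < c) :
    ∃ φ : unitInterval ≃o unitInterval,
      dist γ₁.toContinuousMap (γ₂.reparam φ).toContinuousMap < c :=
  exists_lt_of_ciInf_lt h

/-- The starting point is a `1`-Lipschitz functional of the curve for the reparametrisation
distance (Aizenman–Burchard 1999, §2.1). [cite: AizenmanBurchard1999, §2.1] -/
lemma dist_source_le (γ₁ γ₂ : Curve E) : dist γ₁.source γ₂.source ≤ dist γ₁ γ₂ := by
  refine le_of_forall_gt_imp_ge_of_dense fun c hc ↦ ?_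
  obtain ⟨φ, hφ⟩ := exists_dist_reparam_lt hc
  rw [← source_reparam γ₂ φ]
  exact ((ContinuousMap.dist_apply_le_dist (f := γ₁.toContinuousMap)
    (g := (γ₂.reparam φ).toContinuousMap) 0).trans hφ.le)

/-- The end point is a `1`-Lipschitz functional of the curve for the reparametrisation
distance (Aizenman–Burchard 1999, §2.1). [cite: AizenmanBurchard1999, §2.1] -/
lemma dist_target_le (γ₁ γ₂ : Curve E) : dist γ₁.target γ₂.target ≤ dist γ₁ γ₂ := by
  refine le_of_forall_gt_imp_ge_of_dense fun c hc ↦ ?_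
  obtain ⟨φ, hφ⟩ := exists_dist_reparam_lt hc
  rw [← target_reparam γ₂ φ]
  exact ((ContinuousMap.dist_apply_le_dist (f := γ₁.toContinuousMap)
    (g := (γ₂.reparam φ).toContinuousMap) 1).trans hφ.le)

/-- Every point of the first curve is within `dist γ₁ γ₂` of the trace of the second
(Aizenman–Burchard 1999, §2.1). [cite: AizenmanBurchard1999, §2.1] -/
lemma infDist_range_le (γ₁ γ₂ : Curve E) (t : unitInterval) :
    Metric.infDist (γ₁ t) γ₂.range ≤ dist γ₁ γ₂ := by
  refine le_of_forall_gt_imp_ge_of_dense fun c hc ↦ ?_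
  obtain ⟨φ, hφ⟩ := exists_dist_reparam_lt hc
  refine (Metric.infDist_le_dist_of_mem (mem_range.2 ⟨φ t, rfl⟩)).trans ?_
  exact ((ContinuousMap.dist_apply_le_dist (f := γ₁.toContinuousMap)
    (g := (γ₂.reparam φ).toContinuousMap) t).trans hφ.le)

/-- Push-forward along a continuous map respects distance zero: if `dist γ₁ γ₂ = 0` then
`dist (γ₁.map f) (γ₂.map f) = 0`. The proof uses uniform continuity of `f` on the compact set
`range γ₁ ∪ range γ₂` (Heine–Cantor) (Aizenman–Burchard 1999, §2.1). [cite: AizenmanBurchard1999, §2.1] -/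
lemma dist_map_map_eq_zero (f : C(E, F)) {γ₁ γ₂ : Curve E} (h : dist γ₁ γ₂ = 0) :
    dist (γ₁.map f) (γ₂.map f) = 0 := by
  refine le_antisymm (le_of_forall_gt_imp_ge_of_dense fun ε hε ↦ ?_) dist_nonneg
  have hK : IsCompact (γ₁.range ∪ γ₂.range) := γ₁.isCompact_range.union γ₂.isCompact_range
  have hu := hK.uniformContinuousOn_of_continuous f.continuous.continuousOn
  obtain ⟨δ, hδ, hf⟩ := Metric.uniformContinuousOn_iff.1 hu ε hε
  obtain ⟨φ, hφ⟩ := exists_dist_reparam_lt (γ₁ := γ₁) (γ₂ := γ₂) (h ▸ hδ)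
  refine (reparamDist_le _ _ φ).trans ((ContinuousMap.dist_le hε.le).2 fun t ↦ ?_)
  refine (hf (γ₁ t) (Or.inl ⟨t, rfl⟩) (γ₂ (φ t)) (Or.inr ⟨φ t, rfl⟩) ?_).le
  exact (ContinuousMap.dist_apply_le_dist (f := γ₁.toContinuousMap)
    (g := (γ₂.reparam φ).toContinuousMap) t).trans_lt hφ

/-- Forgetting that a continuous map `unitInterval → E` is parametrised: the canonical map from
`C(unitInterval, E)` (sup distance) onto `Curve E` (reparametrisation distance) is `1`-Lipschitz
(Aizenman–Burchard 1999, §2.a). [cite: AizenmanBurchardDuke1999, §2.a eq. (2.1)] -/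
lemma lipschitzWith_mk : LipschitzWith 1 (Curve.mk : C(unitInterval, E) → Curve E) :=
  LipschitzWith.mk_one fun f g ↦ dist_le_dist_toContinuousMap ⟨f⟩ ⟨g⟩

/-- Every curve is the image of its parametrisation (Aizenman–Burchard 1999, §2.a). [cite: AizenmanBurchardDuke1999, §2.a] -/
lemma surjective_mk : Function.Surjective (Curve.mk : C(unitInterval, E) → Curve E) :=
  fun γ ↦ ⟨γ.toContinuousMap, rfl⟩

/-- Telescoped reparametrisations: `telescope φ 0 = id` and
`telescope φ (n+1) = φ n ∘ telescope φ n` (as `OrderIso.trans`), so that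
`(γ.reparam (φ n)).reparam (telescope φ n) = γ.reparam (telescope φ (n + 1))`; the bookkeeping
device of the standard completeness argument (Aizenman–Burchard 1999, §2.a p. 12). [cite: AizenmanBurchardDuke1999, §2.a p. 12] -/
def telescope (φ : ℕ → unitInterval ≃o unitInterval) : ℕ → unitInterval ≃o unitInterval
  | 0 => OrderIso.refl _
  | n + 1 => (telescope φ n).trans (φ n)

/-- The defining recursion of `telescope` in terms of curves (Aizenman–Burchard 1999, §2.a). [cite: AizenmanBurchardDuke1999, §2.a p. 12] -/
lemma reparam_reparam_telescope (γ : Curve E) (φ : ℕ → unitInterval ≃o unitInterval) (n : ℕ) :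
    (γ.reparam (φ n)).reparam (telescope φ n) = γ.reparam (telescope φ (n + 1)) :=
  reparam_reparam γ (φ n) (telescope φ n)

/-- **Completeness of curve space.** Parametrised curves in a complete space form a complete
pseudo-metric space for the reparametrisation distance (Aizenman–Burchard, Duke Math. J. 99
(1999), §2.a p. 12: "with this metric, `S_Λ` is complete"; §4 p. 22: "standard arguments, such
as used for `C([0,1], ℝ^d)`, show that the space of curves is a complete and separable metric
space"). Proof: by `Metric.complete_of_convergent_controlled_sequences` it suffices to treat
sequences with `dist (u n) (u (n+1)) < 2⁻ⁿ`; choose reparametrisations `φ n` with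
`sup_t dist (u n t) (u (n+1) (φ n t)) < 2⁻ⁿ`, telescope them, get a Cauchy sequence in the
complete space `C(unitInterval, E)`, and bound the distance to its limit by the sup distance. [cite: AizenmanBurchardDuke1999, §2.a p. 12 and §4 p. 22] -/
instance instCompleteSpace [CompleteSpace E] : CompleteSpace (Curve E) := by
  refine Metric.complete_of_convergent_controlled_sequences (fun n ↦ (1 / 2 : ℝ) ^ n)
    (fun n ↦ by positivity) fun u hu ↦ ?_
  have hφ : ∀ n, ∃ φ : unitInterval ≃o unitInterval,
      dist (u n).toContinuousMap ((u (n + 1)).reparam φ).toContinuousMap < (1 / 2 : ℝ) ^ n :=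
    fun n ↦ exists_dist_reparam_lt (hu n n (n + 1) le_rfl n.le_succ)
  choose φ hφ using hφ
  -- the reparametrised curves `w n = u n ∘ telescope φ n` form a Cauchy sequence for the sup
  -- distance
  set w : ℕ → C(unitInterval, E) := fun n ↦ ((u n).reparam (telescope φ n)).toContinuousMap
    with hw
  have hw_succ : ∀ n, dist (w n) (w (n + 1)) ≤ 1 * (1 / 2 : ℝ) ^ n := fun n ↦ by
    rw [one_mul, hw]
    dsimp only
    rw [← reparam_reparam_telescope]
    exact (dist_reparam_reparam_le _ _ _).trans (hφ n).le
  obtain ⟨g, hg⟩ := cauchySeq_tendsto_of_complete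
    (cauchySeq_of_le_geometric (1 / 2 : ℝ) 1 (by norm_num) hw_succ)
  refine ⟨⟨g⟩, tendsto_iff_dist_tendsto_zero.2 ?_⟩
  refine squeeze_zero (fun n ↦ dist_nonneg) (fun n ↦ ?_) (tendsto_iff_dist_tendsto_zero.1 hg)
  calc dist (u n) (⟨g⟩ : Curve E)
      ≤ dist (u n) ((u n).reparam (telescope φ n)) + dist ((u n).reparam (telescope φ n)) ⟨g⟩ :=
        dist_triangle _ _ _
    _ = dist ((u n).reparam (telescope φ n)) (⟨g⟩ : Curve E) := by rw [dist_reparam_self, zero_add]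
    _ ≤ dist (w n) g := dist_le_dist_toContinuousMap _ _

/-- **Separability of curve space.** Parametrised curves in a separable metric space form a
separable pseudo-metric space: `Curve E` is the continuous image of `C(unitInterval, E)`, which
is separable (`ContinuousMap.instSeparableSpace`) (Aizenman–Burchard, Duke Math. J. 99 (1999),
§4 p. 22). [cite: AizenmanBurchardDuke1999, §4 p. 22] -/
instance instSeparableSpace [SecondCountableTopology E] : TopologicalSpace.SeparableSpace (Curve E) :=
  surjective_mk.denseRange.separableSpace lipschitzWith_mk.continuous

/-- Parametrised curves in a separable metric space form a second countable pseudo-metric space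
(Aizenman–Burchard, Duke Math. J. 99 (1999), §4 p. 22). [cite: AizenmanBurchardDuke1999, §4 p. 22] -/
instance instSecondCountableTopology [SecondCountableTopology E] :
    SecondCountableTopology (Curve E) :=
  UniformSpace.secondCountable_of_separable (Curve E)

end PseudoMetric

section Metric

variable [MetricSpace E]

/-- Curves at reparametrisation distance zero have the same starting point
(Aizenman–Burchard 1999, §2.1). [cite: AizenmanBurchard1999, §2.1] -/
lemma source_eq_of_dist_eq_zero {γ₁ γ₂ : Curve E} (h : dist γ₁ γ₂ = 0) :
    γ₁.source = γ₂.source :=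
  dist_le_zero.1 (h ▸ dist_source_le γ₁ γ₂)

/-- Curves at reparametrisation distance zero have the same end point
(Aizenman–Burchard 1999, §2.1). [cite: AizenmanBurchard1999, §2.1] -/
lemma target_eq_of_dist_eq_zero {γ₁ γ₂ : Curve E} (h : dist γ₁ γ₂ = 0) :
    γ₁.target = γ₂.target :=
  dist_le_zero.1 (h ▸ dist_target_le γ₁ γ₂)

/-- Curves at reparametrisation distance zero have the same trace: each point of `range γ₁` is at
distance zero from the compact, hence closed, set `range γ₂` (Aizenman–Burchard 1999, §2.1). [cite: AizenmanBurchard1999, §2.1] -/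
lemma range_eq_of_dist_eq_zero {γ₁ γ₂ : Curve E} (h : dist γ₁ γ₂ = 0) :
    γ₁.range = γ₂.range := by
  have key : ∀ {γ₁ γ₂ : Curve E}, dist γ₁ γ₂ = 0 → γ₁.range ⊆ γ₂.range := by
    intro γ₁ γ₂ h
    rintro _ ⟨t, rfl⟩
    rw [γ₂.isCompact_range.isClosed.mem_iff_infDist_zero γ₂.range_nonempty]
    exact le_antisymm (h ▸ infDist_range_le γ₁ γ₂ t) Metric.infDist_nonneg
  exact (key h).antisymm (key (dist_comm γ₁ γ₂ ▸ h))

end Metric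

/-- A curve is *simple* if its parametrisation is injective (Aizenman–Burchard 1999, §2.1;
used for SLE/interface statements: simple scaling limits). [cite: AizenmanBurchard1999, §2.1] -/
def IsSimple [TopologicalSpace E] (γ : Curve E) : Prop := Function.Injective γ

end Curve

/-- The space of curves in `E` modulo increasing reparametrisation, realised as the metric
quotient (`SeparationQuotient`) of `Curve E` for the reparametrisation pseudo-metric; Mathlib's
`SeparationQuotient.instMetricSpace` makes it a metric space
(Aizenman–Burchard, Duke Math. J. 99 (1999), §2.1: the space `S_Λ` of curves). [folklore] -/
abbrev CurveClass (E : Type*) [PseudoMetricSpace E] : Type _ := SeparationQuotient (Curve E)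

namespace CurveClass

section PseudoMetric

variable [PseudoMetricSpace E] [PseudoMetricSpace F]

/-- The class of a parametrised curve modulo reparametrisation (Aizenman–Burchard 1999, §2.1). [cite: AizenmanBurchard1999, §2.1] -/
noncomputable def mk : Curve E → CurveClass E := SeparationQuotient.mk

/-- `CurveClass.mk` is Mathlib's `SeparationQuotient.mk` (Aizenman–Burchard 1999, §2.1). [cite: AizenmanBurchard1999, §2.1] -/
lemma mk_eq_separationQuotientMk : (mk : Curve E → CurveClass E) = SeparationQuotient.mk := rfl

/-- Two curves define the same class iff their reparametrisation distance vanishes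
(Aizenman–Burchard 1999, §2.1). [cite: AizenmanBurchard1999, §2.1] -/
lemma mk_eq_mk {γ₁ γ₂ : Curve E} : mk γ₁ = mk γ₂ ↔ Curve.reparamDist γ₁ γ₂ = 0 :=
  SeparationQuotient.mk_eq_mk.trans Metric.inseparable_iff

/-- Two curves define the same class iff they are at distance zero
(Aizenman–Burchard 1999, §2.1). [cite: AizenmanBurchard1999, §2.1] -/
lemma mk_eq_mk_iff_dist_eq_zero {γ₁ γ₂ : Curve E} : mk γ₁ = mk γ₂ ↔ dist γ₁ γ₂ = 0 := mk_eq_mk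

/-- A reparametrised curve has the same class (Aizenman–Burchard 1999, §2.1). [cite: AizenmanBurchard1999, §2.1] -/
@[simp] lemma mk_reparam (γ : Curve E) (φ : unitInterval ≃o unitInterval) :
    mk (γ.reparam φ) = mk γ :=
  mk_eq_mk_iff_dist_eq_zero.2 (Curve.dist_self_reparam γ φ)

/-- The distance of classes is the reparametrisation distance of representatives
(Aizenman–Burchard 1999, §2.1). [cite: AizenmanBurchard1999, §2.1] -/
@[simp] lemma dist_mk_mk (γ₁ γ₂ : Curve E) : dist (mk γ₁) (mk γ₂) = dist γ₁ γ₂ := rfl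

/-- The quotient map to curve classes is continuous (Aizenman–Burchard 1999, §2.1). [cite: AizenmanBurchard1999, §2.1] -/
@[fun_prop] lemma continuous_mk : Continuous (mk : Curve E → CurveClass E) :=
  SeparationQuotient.continuous_mk

/-- Every curve class has a representative (Aizenman–Burchard 1999, §2.1). [cite: AizenmanBurchard1999, §2.1] -/
lemma surjective_mk : Function.Surjective (mk : Curve E → CurveClass E) :=
  SeparationQuotient.surjective_mk

/-- Curve classes carry the Borel σ-algebra of the quotient metric: laws of random curves are
Borel probability measures on `CurveClass E` (Aizenman–Burchard 1999, §2.1). [cite: AizenmanBurchard1999, §2.1] -/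
noncomputable instance instMeasurableSpace : MeasurableSpace (CurveClass E) := borel _

/-- The σ-algebra on curve classes is the Borel σ-algebra (Aizenman–Burchard 1999, §2.1). [cite: AizenmanBurchard1999, §2.1] -/
instance instBorelSpace : BorelSpace (CurveClass E) := ⟨rfl⟩

/-- The quotient map to curve classes is Borel measurable (Aizenman–Burchard 1999, §2.1). [cite: AizenmanBurchard1999, §2.1] -/
@[fun_prop] lemma measurable_mk : Measurable (mk : Curve E → CurveClass E) :=
  continuous_mk.measurable

/-- Push a curve class forward along a continuous map `f : C(E, F)`; well defined because
push-forward preserves reparametrisation distance zero (`Curve.dist_map_map_eq_zero`,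
via uniform continuity of `f` on compact traces) (Aizenman–Burchard 1999, §2.1; used for
conformal invariance statements). [cite: AizenmanBurchard1999, §2.1] -/
noncomputable def map (f : C(E, F)) : CurveClass E → CurveClass F :=
  SeparationQuotient.lift (mk ∘ Curve.map f) fun _ _ h ↦
    mk_eq_mk_iff_dist_eq_zero.2 (Curve.dist_map_map_eq_zero f (Metric.inseparable_iff.1 h))

/-- Push-forward of the class of a curve (Aizenman–Burchard 1999, §2.1). [cite: AizenmanBurchard1999, §2.1] -/
@[simp] lemma map_mk (f : C(E, F)) (γ : Curve E) : map f (mk γ) = mk (γ.map f) := rfl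

/-- Push-forward along a `K`-Lipschitz map is `K`-Lipschitz on curve classes
(Aizenman–Burchard 1999, §2.1). [cite: AizenmanBurchard1999, §2.1] -/
lemma lipschitzWith_map {K : NNReal} {f : C(E, F)} (hf : LipschitzWith K f) :
    LipschitzWith K (map f) :=
  LipschitzWith.of_dist_le_mul fun c₁ c₂ ↦ by
    obtain ⟨γ₁, rfl⟩ := surjective_mk c₁
    obtain ⟨γ₂, rfl⟩ := surjective_mk c₂
    simpa using Curve.dist_map_map_le hf γ₁ γ₂

/-- Curve classes in a complete space form a complete metric space
(Aizenman–Burchard, Duke Math. J. 99 (1999), §2.1, discussion after eq. (2.2)). A theorem, not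
an instance; use via `haveI`. [cite: AizenmanBurchardDuke1999, §2.1 (discussion after eq. (2.2))] -/
def completeSpace : Prop :=
  ∀ [CompleteSpace E],
    CompleteSpace (CurveClass E)

/-- Curve classes in a separable space form a separable (second countable) metric space
(Aizenman–Burchard, Duke Math. J. 99 (1999), §2.1). A theorem, not an instance. [cite: AizenmanBurchardDuke1999, §2.1] -/
def secondCountableTopology : Prop :=
  ∀ [SecondCountableTopology E],
    SecondCountableTopology (CurveClass E)

/-- Curve classes in a Polish (complete separable) metric space form a Polish space
(Aizenman–Burchard, Duke Math. J. 99 (1999), §2.1). A theorem, not an instance; use via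
`haveI`. [cite: AizenmanBurchardDuke1999, §2.1] -/
def polishSpace : Prop :=
  ∀ [CompleteSpace E] [SecondCountableTopology E],
    PolishSpace (CurveClass E)

/-- Curve classes in a complete space form a complete metric space: the metric quotient of the
complete pseudo-metric space `Curve E` (`Curve.instCompleteSpace`,
`SeparationQuotient.instCompleteSpace`) (Aizenman–Burchard, Duke Math. J. 99 (1999), §2.a
p. 12). [cite: AizenmanBurchardDuke1999, §2.a p. 12 (after eq. (2.2))] -/
instance instCompleteSpace [CompleteSpace E] : CompleteSpace (CurveClass E) :=
  inferInstance

/-- Curve classes in a separable metric space form a separable metric space: a continuous image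
of the separable space `Curve E` (Aizenman–Burchard, Duke Math. J. 99 (1999), §4 p. 22). [cite: AizenmanBurchardDuke1999, §4 p. 22] -/
instance instSeparableSpace [SecondCountableTopology E] : TopologicalSpace.SeparableSpace (CurveClass E) :=
  surjective_mk.denseRange.separableSpace continuous_mk

/-- Curve classes in a separable metric space form a second countable metric space
(Aizenman–Burchard, Duke Math. J. 99 (1999), §4 p. 22). [cite: AizenmanBurchardDuke1999, §4 p. 22] -/
instance instSecondCountableTopology [SecondCountableTopology E] :
    SecondCountableTopology (CurveClass E) :=
  UniformSpace.secondCountable_of_separable (CurveClass E)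

/-- Curve classes in a complete separable metric space form a Polish space
(Aizenman–Burchard, Duke Math. J. 99 (1999), §4 p. 22: "a complete and separable metric
space"). [cite: AizenmanBurchardDuke1999, §4 p. 22] -/
instance instPolishSpace [CompleteSpace E] [SecondCountableTopology E] :
    PolishSpace (CurveClass E) :=
  inferInstance

/-- Discharge of the named fact `CurveClass.completeSpace`
(Aizenman–Burchard, Duke Math. J. 99 (1999), §2.a p. 12). [cite: AizenmanBurchardDuke1999, §2.a p. 12 (after eq. (2.2))] -/
theorem completeSpace_holds : completeSpace (E := E) := by
  intro
  infer_instance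

/-- Discharge of the named fact `CurveClass.secondCountableTopology`
(Aizenman–Burchard, Duke Math. J. 99 (1999), §4 p. 22). [cite: AizenmanBurchardDuke1999, §4 p. 22] -/
theorem secondCountableTopology_holds : secondCountableTopology (E := E) := by
  intro
  infer_instance

/-- Discharge of the named fact `CurveClass.polishSpace`: curve classes in a complete separable
metric space form a Polish space (Aizenman–Burchard, Duke Math. J. 99 (1999), §2.a p. 12
(completeness) and §4 p. 22 (complete and separable)). [cite: AizenmanBurchardDuke1999, §2.a p. 12 and §4 p. 22] -/
theorem polishSpace_holds : polishSpace (E := E) := by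
  intro _ _
  infer_instance

end PseudoMetric

section Metric

variable [MetricSpace E]

/-- The starting point of a curve class (Aizenman–Burchard 1999, §2.1). [cite: AizenmanBurchard1999, §2.1] -/
noncomputable def source : CurveClass E → E :=
  SeparationQuotient.lift Curve.source fun _ _ h ↦
    Curve.source_eq_of_dist_eq_zero (Metric.inseparable_iff.1 h)

/-- The end point of a curve class (Aizenman–Burchard 1999, §2.1). [cite: AizenmanBurchard1999, §2.1] -/
noncomputable def target : CurveClass E → E :=
  SeparationQuotient.lift Curve.target fun _ _ h ↦
    Curve.target_eq_of_dist_eq_zero (Metric.inseparable_iff.1 h)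

/-- The trace in `E` of a curve class (Aizenman–Burchard 1999, §2.1). [cite: AizenmanBurchard1999, §2.1] -/
noncomputable def range : CurveClass E → Set E :=
  SeparationQuotient.lift Curve.range fun _ _ h ↦
    Curve.range_eq_of_dist_eq_zero (Metric.inseparable_iff.1 h)

/-- The starting point of the class of `γ` is `γ 0` (Aizenman–Burchard 1999, §2.1). [cite: AizenmanBurchard1999, §2.1] -/
@[simp] lemma source_mk (γ : Curve E) : (mk γ).source = γ.source := rfl

/-- The end point of the class of `γ` is `γ 1` (Aizenman–Burchard 1999, §2.1). [cite: AizenmanBurchard1999, §2.1] -/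
@[simp] lemma target_mk (γ : Curve E) : (mk γ).target = γ.target := rfl

/-- The trace of the class of `γ` is the trace of `γ` (Aizenman–Burchard 1999, §2.1). [cite: AizenmanBurchard1999, §2.1] -/
@[simp] lemma range_mk (γ : Curve E) : (mk γ).range = γ.range := rfl

/-- The trace of a curve class is compact (Aizenman–Burchard 1999, §2.1). [cite: AizenmanBurchard1999, §2.1] -/
lemma isCompact_range (c : CurveClass E) : IsCompact c.range := by
  obtain ⟨γ, rfl⟩ := surjective_mk c
  exact γ.isCompact_range

/-- The trace of a curve class is nonempty (Aizenman–Burchard 1999, §2.1). [cite: AizenmanBurchard1999, §2.1] -/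
lemma range_nonempty (c : CurveClass E) : c.range.Nonempty := by
  obtain ⟨γ, rfl⟩ := surjective_mk c
  exact γ.range_nonempty

/-- The endpoints of a curve class lie on its trace (Aizenman–Burchard 1999, §2.1). [cite: AizenmanBurchard1999, §2.1] -/
lemma source_mem_range (c : CurveClass E) : c.source ∈ c.range := by
  obtain ⟨γ, rfl⟩ := surjective_mk c
  exact ⟨0, rfl⟩

/-- The endpoints of a curve class lie on its trace (Aizenman–Burchard 1999, §2.1). [cite: AizenmanBurchard1999, §2.1] -/
lemma target_mem_range (c : CurveClass E) : c.target ∈ c.range := by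
  obtain ⟨γ, rfl⟩ := surjective_mk c
  exact ⟨1, rfl⟩

/-- The starting point is a `1`-Lipschitz functional (Aizenman–Burchard 1999, §2.1). [cite: AizenmanBurchard1999, §2.1] -/
lemma lipschitzWith_source : LipschitzWith 1 (source : CurveClass E → E) :=
  LipschitzWith.mk_one fun c₁ c₂ ↦ by
    obtain ⟨γ₁, rfl⟩ := surjective_mk c₁
    obtain ⟨γ₂, rfl⟩ := surjective_mk c₂
    exact Curve.dist_source_le γ₁ γ₂

/-- The end point is a `1`-Lipschitz functional (Aizenman–Burchard 1999, §2.1). [cite: AizenmanBurchard1999, §2.1] -/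
lemma lipschitzWith_target : LipschitzWith 1 (target : CurveClass E → E) :=
  LipschitzWith.mk_one fun c₁ c₂ ↦ by
    obtain ⟨γ₁, rfl⟩ := surjective_mk c₁
    obtain ⟨γ₂, rfl⟩ := surjective_mk c₂
    exact Curve.dist_target_le γ₁ γ₂

/-- The starting point depends continuously on the curve class (Aizenman–Burchard 1999, §2.1). [cite: AizenmanBurchard1999, §2.1] -/
@[fun_prop] lemma continuous_source : Continuous (source : CurveClass E → E) :=
  lipschitzWith_source.continuous

/-- The end point depends continuously on the curve class (Aizenman–Burchard 1999, §2.1). [cite: AizenmanBurchard1999, §2.1] -/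
@[fun_prop] lemma continuous_target : Continuous (target : CurveClass E → E) :=
  lipschitzWith_target.continuous

/-- The trace of a pushed-forward class is the image of the trace
(Aizenman–Burchard 1999, §2.1). [cite: AizenmanBurchard1999, §2.1] -/
@[simp] lemma range_map {F : Type*} [MetricSpace F] (f : C(E, F)) (c : CurveClass E) :
    (c.map f).range = f '' c.range := by
  obtain ⟨γ, rfl⟩ := surjective_mk c
  simp

/-- The starting point of a pushed-forward class (Aizenman–Burchard 1999, §2.1). [cite: AizenmanBurchard1999, §2.1] -/
@[simp] lemma source_map {F : Type*} [MetricSpace F] (f : C(E, F)) (c : CurveClass E) :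
    (c.map f).source = f c.source := by
  obtain ⟨γ, rfl⟩ := surjective_mk c
  rfl

/-- The end point of a pushed-forward class (Aizenman–Burchard 1999, §2.1). [cite: AizenmanBurchard1999, §2.1] -/
@[simp] lemma target_map {F : Type*} [MetricSpace F] (f : C(E, F)) (c : CurveClass E) :
    (c.map f).target = f c.target := by
  obtain ⟨γ, rfl⟩ := surjective_mk c
  rfl

/-- The event "the curve hits `A` before `B`": some representative visits `A` at a time `t`
before which (inclusively) it has not visited `B` (Aizenman–Burchard 1999, §2.1; crossing
events of interfaces, e.g. Cardy/Smirnov crossing probabilities). [cite: AizenmanBurchard1999, §2.1] -/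
noncomputable def hitsBefore (A B : Set E) : Set (CurveClass E) :=
  mk '' {γ : Curve E | ∃ t, γ t ∈ A ∧ ∀ s ≤ t, γ s ∉ B}

/-- The event "the curve stays inside `S`" (Aizenman–Burchard 1999, §2.1). [cite: AizenmanBurchard1999, §2.1] -/
def rangeSubset (S : Set E) : Set (CurveClass E) := {c | c.range ⊆ S}

/-- The event "the curve is simple": some representative is injective
(Aizenman–Burchard 1999, §2.1). [cite: AizenmanBurchard1999, §2.1] -/
noncomputable def simple : Set (CurveClass E) := mk '' {γ : Curve E | γ.IsSimple}

/-- Membership in `rangeSubset` (Aizenman–Burchard 1999, §2.1). [cite: AizenmanBurchard1999, §2.1] -/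
@[simp] lemma mem_rangeSubset {S : Set E} {c : CurveClass E} :
    c ∈ rangeSubset S ↔ c.range ⊆ S := Iff.rfl

/-- The class of a curve lies in `rangeSubset S` iff the curve stays in `S`
(Aizenman–Burchard 1999, §2.1). [cite: AizenmanBurchard1999, §2.1] -/
lemma mk_mem_rangeSubset {S : Set E} {γ : Curve E} :
    mk γ ∈ rangeSubset S ↔ ∀ t, γ t ∈ S := by
  simp [Curve.range, Set.range_subset_iff]

/-- A curve hitting `A` before `B` gives a class in `hitsBefore A B`
(Aizenman–Burchard 1999, §2.1). [cite: AizenmanBurchard1999, §2.1] -/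
lemma mk_mem_hitsBefore {A B : Set E} {γ : Curve E} {t : unitInterval} (hA : γ t ∈ A)
    (hB : ∀ s ≤ t, γ s ∉ B) : mk γ ∈ hitsBefore A B :=
  ⟨γ, ⟨t, hA, hB⟩, rfl⟩

/-- A simple curve gives a class in `simple` (Aizenman–Burchard 1999, §2.1). [cite: AizenmanBurchard1999, §2.1] -/
lemma mk_mem_simple {γ : Curve E} (h : γ.IsSimple) : mk γ ∈ simple := ⟨γ, h, rfl⟩

/-- Staying inside a closed set is a closed event: `range` is upper semicontinuous for the
Hausdorff distance (Aizenman–Burchard 1999, §2.1). [cite: AizenmanBurchard1999, §2.1] -/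
theorem isClosed_rangeSubset {S : Set E} (hS : IsClosed S) : IsClosed (rangeSubset S) := by
  rw [← isOpen_compl_iff, Metric.isOpen_iff]
  rintro c hc
  obtain ⟨γ, rfl⟩ := surjective_mk c
  simp only [mem_compl_iff, mk_mem_rangeSubset, not_forall] at hc
  obtain ⟨t, ht⟩ := hc
  obtain ⟨ε, hε, hball⟩ := Metric.isOpen_iff.1 hS.isOpen_compl (γ t) ht
  refine ⟨ε, hε, fun c' hc' hS' ↦ ?_⟩
  obtain ⟨γ', rfl⟩ := surjective_mk c'
  rw [Metric.mem_ball, dist_comm, dist_mk_mk] at hc'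
  have h := (Curve.infDist_range_le γ γ' t).trans_lt hc'
  rw [Metric.infDist_lt_iff γ'.range_nonempty] at h
  obtain ⟨y, hy, hxy⟩ := h
  exact hball (Metric.mem_ball'.2 hxy) (hS' hy)

/-- Hitting a closed set `A` before a closed set `B` is a Borel event
(Aizenman–Burchard 1999, §2.1; measurability of crossing events). [cite: AizenmanBurchard1999, §2.1] -/
def measurableSet_hitsBefore : Prop :=
  ∀ {A B : Set E} (hA : IsClosed A) (hB : IsClosed B),
    MeasurableSet (hitsBefore A B)

/-- Simplicity is a Borel event in curve space (Aizenman–Burchard 1999, §2.1). [cite: AizenmanBurchard1999, §2.1] -/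
def measurableSet_simple : Prop :=
  ∀ [CompleteSpace E] [SecondCountableTopology E],
    MeasurableSet (simple : Set (CurveClass E))

/-- Staying inside a closed set is a Borel event (Aizenman–Burchard 1999, §2.1). [cite: AizenmanBurchard1999, §2.1] -/
theorem measurableSet_rangeSubset {S : Set E} (hS : IsClosed S) :
    MeasurableSet (rangeSubset S) :=
  (isClosed_rangeSubset hS).measurableSet

end Metric

end CurveClass

/-! ### Law-level combinators: tightness and convergence in law as the mesh tends to `0⁺` -/

section Laws

/-- A family of laws `μ δ` indexed by a mesh parameter `δ` is *tight* if the set of laws with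
`δ ∈ (0, 1]` is a tight set of measures (Mathlib's `IsTightMeasureSet`): for every `ε > 0` there
is a compact `K` with `μ δ Kᶜ ≤ ε` for all `0 < δ ≤ 1` (Billingsley, *Convergence of probability
measures*, 2nd ed., §1.5; Aizenman–Burchard, Duke Math. J. 99 (1999), Thm 1.1: tightness of
random-curve laws). [folklore] -/
def IsTightLaws {X : Type*} [TopologicalSpace X] [MeasurableSpace X] (μ : ℝ → Measure X) :
    Prop :=
  IsTightMeasureSet (μ '' Set.Ioc 0 1)

/-- Convergence in law of the random variables `Y δ : Ωδ δ → X` under `P δ` to `Z : Ω' → X`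
under `P'` as the mesh `δ → 0⁺`, in portmanteau form: for every bounded continuous
`f : X →ᵇ ℝ`, `∫ f (Y δ ω) dP δ → ∫ f (Z ω) dP'` along `𝓝[>] 0`. No probability or
measurability hypotheses are built in; under the usual ones this is Mathlib's
`TendstoInDistribution` along `𝓝[>] 0` (`tendstoLaw_iff_tendstoInDistribution`)
(Billingsley, *Convergence of probability measures*, 2nd ed., §1.2 and Thm 2.1). [folklore] -/
def TendstoLaw {Ωδ : ℝ → Type*} [∀ δ, MeasurableSpace (Ωδ δ)] {Ω' : Type*} [MeasurableSpace Ω']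
    {X : Type*} [TopologicalSpace X] (Y : ∀ δ, Ωδ δ → X) (P : ∀ δ, Measure (Ωδ δ)) (Z : Ω' → X)
    (P' : Measure Ω') : Prop :=
  ∀ f : X →ᵇ ℝ, Tendsto (fun δ ↦ ∫ ω, f (Y δ ω) ∂P δ) (𝓝[>] (0 : ℝ)) (𝓝 (∫ ω, f (Z ω) ∂P'))

/-- For probability measures and a.e.-measurable random variables with values in a Borel space,
`TendstoLaw` is Mathlib's convergence in distribution along the filter `𝓝[>] 0`
(Billingsley, *Convergence of probability measures*, 2nd ed., Thm 2.1 (portmanteau);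
proof: `ProbabilityMeasure.tendsto_iff_forall_integral_tendsto` and `integral_map`). [folklore] -/
theorem tendstoLaw_iff_tendstoInDistribution {Ωδ : ℝ → Type*} [∀ δ, MeasurableSpace (Ωδ δ)]
    {Ω' : Type*} [MeasurableSpace Ω'] {X : Type*} [TopologicalSpace X] [MeasurableSpace X]
    [BorelSpace X] {Y : ∀ δ, Ωδ δ → X} {P : ∀ δ, Measure (Ωδ δ)}
    [∀ δ, IsProbabilityMeasure (P δ)] {Z : Ω' → X} {P' : Measure Ω'} [IsProbabilityMeasure P']
    (hY : ∀ δ, AEMeasurable (Y δ) (P δ)) (hZ : AEMeasurable Z P') :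
    TendstoLaw Y P Z P' ↔ TendstoInDistribution Y (𝓝[>] (0 : ℝ)) Z P P' := by
  have key : TendstoLaw Y P Z P' ↔ Tendsto (β := ProbabilityMeasure X)
      (fun δ ↦ ⟨(P δ).map (Y δ), Measure.isProbabilityMeasure_map (hY δ)⟩) (𝓝[>] (0 : ℝ))
      (𝓝 ⟨P'.map Z, Measure.isProbabilityMeasure_map hZ⟩) := by
    rw [ProbabilityMeasure.tendsto_iff_forall_integral_tendsto]
    refine forall_congr' fun f ↦ ?_
    simp only [ProbabilityMeasure.coe_mk]
    rw [integral_map hZ f.continuous.aestronglyMeasurable]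
    simp_rw [integral_map (hY _) f.continuous.aestronglyMeasurable]
  rw [key]
  exact ⟨fun h ↦ ⟨hY, hZ, h⟩, fun h ↦ h.tendsto⟩

end Laws

/-! ### Discharge: crossing events `hitsBefore A B` are Borel -/

namespace CurveClass

section HitsBeforeMeasurable

variable [MetricSpace E]

/-- Quantitative approximants of the crossing event: the curves visiting the open
`a`-neighbourhood of `A` at a time up to which they stay at distance `> b` from `B`. These sets
are open for the reparametrisation distance (`isOpen_hitsBeforeApprox`) and exhaust the crossing
event (`hitsBefore_eq_iUnion_iInter`) (Aizenman–Burchard 1999, §2.1: crossing events).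
[folklore] -/
def hitsBeforeApprox (A B : Set E) (a b : ℝ) : Set (Curve E) :=
  {γ | ∃ t, Metric.infDist (γ t) A < a ∧ ∀ s ≤ t, b < Metric.infDist (γ s) B}

/-- The approximants `hitsBeforeApprox A B a b` are open in `Curve E`: both defining conditions
have slack (the second one uniformly on the compact interval `[0, t]`), and a curve at
reparametrisation distance `< ε` has a reparametrisation uniformly `ε`-close
(Aizenman–Burchard 1999, §2.1). [folklore] -/
theorem isOpen_hitsBeforeApprox (A B : Set E) (a b : ℝ) : IsOpen (hitsBeforeApprox A B a b) := by
  rw [Metric.isOpen_iff]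
  rintro γ ⟨t, htA, htB⟩
  have hγc : Continuous γ := γ.toContinuousMap.continuous
  have hcont : Continuous fun s : unitInterval ↦ Metric.infDist (γ s) B :=
    (Metric.continuous_infDist_pt B).comp hγc
  obtain ⟨s₀, hs₀, hmin⟩ :=
    isClosed_Iic.isCompact.exists_isMinOn (nonempty_Iic (a := t)) hcont.continuousOn
  have hαpos : 0 < a - Metric.infDist (γ t) A := sub_pos.2 htA
  have hβpos : 0 < Metric.infDist (γ s₀) B - b := sub_pos.2 (htB s₀ hs₀)
  refine ⟨min (a - Metric.infDist (γ t) A) (Metric.infDist (γ s₀) B - b),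
    lt_min hαpos hβpos, fun γ' hγ' ↦ ?_⟩
  rw [Metric.mem_ball, dist_comm] at hγ'
  obtain ⟨φ, hφ⟩ := Curve.exists_dist_reparam_lt hγ'
  have hclose : ∀ r, dist (γ r) (γ' (φ r)) <
      min (a - Metric.infDist (γ t) A) (Metric.infDist (γ s₀) B - b) := fun r ↦ by
    have h1 := ContinuousMap.dist_apply_le_dist (f := γ.toContinuousMap)
      (g := (γ'.reparam φ).toContinuousMap) (x := r)
    simp only [Curve.coe_toContinuousMap, Curve.reparam_apply] at h1
    exact h1.trans_lt hφ
  refine ⟨φ t, ?_, fun s' hs' ↦ ?_⟩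
  · have h1 := Metric.infDist_le_infDist_add_dist (s := A) (x := γ' (φ t)) (y := γ t)
    have h2 : dist (γ' (φ t)) (γ t) < a - Metric.infDist (γ t) A := by
      rw [dist_comm]
      exact (hclose t).trans_le (min_le_left _ _)
    linarith
  · have hst : φ.symm s' ≤ t := by simpa using φ.symm.monotone hs'
    have h1 := Metric.infDist_le_infDist_add_dist (s := B) (x := γ (φ.symm s')) (y := γ' s')
    have h2 : dist (γ (φ.symm s')) (γ' s') < Metric.infDist (γ s₀) B - b := by
      have := hclose (φ.symm s')
      simp only [OrderIso.apply_symm_apply] at this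
      exact this.trans_le (min_le_right _ _)
    have h3 : Metric.infDist (γ s₀) B ≤ Metric.infDist (γ (φ.symm s')) B :=
      (isMinOn_iff.1 hmin) _ hst
    linarith

/-- Open sets of curves are saturated for "reparametrisation distance zero" (open sets of a
pseudo-metric space contain, with a point, all points at distance zero from it). [folklore] -/
theorem mem_of_isOpen_of_dist_eq_zero {U : Set (Curve E)} (hU : IsOpen U) {γ γ' : Curve E}
    (hγ : γ ∈ U) (h : dist γ γ' = 0) : γ' ∈ U := by
  obtain ⟨ε, hε, hball⟩ := Metric.isOpen_iff.1 hU γ hγ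
  refine hball ?_
  rw [Metric.mem_ball, dist_comm, h]
  exact hε

/-- **The crossing event is a `G_δσ` built from open sets**: for closed nonempty `A, B`,
`hitsBefore A B = ⋃ₙ ⋂ₘ mk '' hitsBeforeApprox A B (1/(m+1)) (1/(n+1))`. "⊆": a curve hitting `A`
at `t` and off the closed set `B` on the compact `[0, t]` is at distance `> 1/(n+1)` from `B`
there. "⊇": if some representatives lie in the approximants then, these being open hence
saturated, one fixed representative `γ` lies in all of them; a subsequential limit `t₀` of the
witnessing times `tₘ` has `infDist (γ t₀) A = 0` and `infDist (γ s) B ≥ 1/(n+1)` for `s ≤ t₀`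
(Aizenman–Burchard 1999, §2.1). [folklore] -/
theorem hitsBefore_eq_iUnion_iInter {A B : Set E} (hA : IsClosed A) (hB : IsClosed B)
    (hAne : A.Nonempty) (hBne : B.Nonempty) :
    hitsBefore A B = ⋃ n : ℕ, ⋂ m : ℕ,
      mk '' hitsBeforeApprox A B (1 / ((m : ℝ) + 1)) (1 / ((n : ℝ) + 1)) := by
  ext c
  simp only [mem_iUnion, mem_iInter]
  constructor
  · rintro ⟨γ, ⟨t, htA, htB⟩, rfl⟩
    have hγc : Continuous γ := γ.toContinuousMap.continuous
    have hcont : Continuous fun s : unitInterval ↦ Metric.infDist (γ s) B :=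
      (Metric.continuous_infDist_pt B).comp hγc
    obtain ⟨s₀, hs₀, hmin⟩ :=
      isClosed_Iic.isCompact.exists_isMinOn (nonempty_Iic (a := t)) hcont.continuousOn
    have hpos : 0 < Metric.infDist (γ s₀) B := (hB.notMem_iff_infDist_pos hBne).1 (htB s₀ hs₀)
    obtain ⟨n, hn⟩ := exists_nat_one_div_lt hpos
    refine ⟨n, fun m ↦ ⟨γ, ⟨t, ?_, fun s hs ↦ ?_⟩, rfl⟩⟩
    · rw [(hA.mem_iff_infDist_zero hAne).1 htA]
      positivity
    · exact hn.trans_le ((isMinOn_iff.1 hmin) s hs)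
  · rintro ⟨n, hn⟩
    obtain ⟨γ, rfl⟩ := surjective_mk c
    have hγ : ∀ m : ℕ, γ ∈ hitsBeforeApprox A B (1 / ((m : ℝ) + 1)) (1 / ((n : ℝ) + 1)) := by
      intro m
      obtain ⟨γ', hγ', hmk⟩ := hn m
      exact mem_of_isOpen_of_dist_eq_zero (isOpen_hitsBeforeApprox _ _ _ _) hγ'
        (mk_eq_mk_iff_dist_eq_zero.1 hmk)
    choose t ht using hγ
    have hγc : Continuous γ := γ.toContinuousMap.continuous
    obtain ⟨t₀, ψ, hψ, hlim⟩ := CompactSpace.tendsto_subseq t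
    have hn0 : (0 : ℝ) < 1 / ((n : ℝ) + 1) := by positivity
    refine ⟨γ, ⟨t₀, ?_, fun s hs ↦ ?_⟩, rfl⟩
    · have h1 : Tendsto (fun k ↦ Metric.infDist (γ (t (ψ k))) A) atTop
          (𝓝 (Metric.infDist (γ t₀) A)) :=
        (((Metric.continuous_infDist_pt A).comp hγc).tendsto t₀).comp hlim
      have h2 : Tendsto (fun k ↦ Metric.infDist (γ (t (ψ k))) A) atTop (𝓝 0) := by
        refine squeeze_zero (fun _ ↦ Metric.infDist_nonneg) (fun k ↦ (ht (ψ k)).1.le) ?_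
        have hψ' : Tendsto (fun k ↦ (ψ k : ℝ) + 1) atTop atTop :=
          tendsto_atTop_add_const_right _ _ (tendsto_natCast_atTop_atTop.comp hψ.tendsto_atTop)
        exact hψ'.const_div_atTop 1
      rw [hA.mem_iff_infDist_zero hAne]
      exact tendsto_nhds_unique h1 h2
    · rcases hs.lt_or_eq with hlt | heq
      · obtain ⟨k, hk⟩ := (hlim.eventually_const_lt hlt).exists
        exact (hB.notMem_iff_infDist_pos hBne).2 (hn0.trans ((ht (ψ k)).2 s hk.le))
      · have h1 : Tendsto (fun k ↦ Metric.infDist (γ (t (ψ k))) B) atTop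
            (𝓝 (Metric.infDist (γ s) B)) := by
          rw [heq]
          exact (((Metric.continuous_infDist_pt B).comp hγc).tendsto t₀).comp hlim
        have h2 : 1 / ((n : ℝ) + 1) ≤ Metric.infDist (γ s) B :=
          ge_of_tendsto' h1 fun k ↦ ((ht (ψ k)).2 _ le_rfl).le
        exact (hB.notMem_iff_infDist_pos hBne).2 (hn0.trans_le h2)

/-- Nothing hits the empty set: `hitsBefore ∅ B = ∅`. [folklore] -/
theorem hitsBefore_empty_left (B : Set E) : hitsBefore (∅ : Set E) B = ∅ := by
  ext c
  simp [hitsBefore]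

/-- With nothing to avoid, `hitsBefore A ∅` is the event "the trace meets `A`", the complement
of `rangeSubset Aᶜ`. [folklore] -/
theorem hitsBefore_empty_right (A : Set E) : hitsBefore A (∅ : Set E) = (rangeSubset Aᶜ)ᶜ := by
  ext c
  obtain ⟨γ, rfl⟩ := surjective_mk c
  rw [mem_compl_iff, mk_mem_rangeSubset]
  constructor
  · rintro ⟨γ', ⟨t, ht, -⟩, hmk⟩ hall
    have hmem : γ' t ∈ (mk γ).range := by
      rw [← hmk, range_mk]
      exact ⟨t, rfl⟩
    rw [range_mk] at hmem
    obtain ⟨s, hs⟩ := Curve.mem_range.1 hmem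
    exact hall s (hs ▸ ht)
  · intro h
    simp only [mem_compl_iff, not_forall, not_not] at h
    obtain ⟨t, ht⟩ := h
    exact ⟨γ, ⟨t, ht, fun _ _ h ↦ h⟩, rfl⟩

/-- Meeting a closed set `A` is a closed event: its complement "the trace stays inside the open
set `Aᶜ`" is open, since a compact trace inside an open set has a thickening inside it and every
point of a nearby class is close to the trace (Aizenman–Burchard 1999, §2.1). [folklore] -/
theorem isClosed_hitsBefore_empty_right {A : Set E} (hA : IsClosed A) :
    IsClosed (hitsBefore A (∅ : Set E)) := by
  rw [hitsBefore_empty_right, isClosed_compl_iff, Metric.isOpen_iff]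
  intro c hc
  obtain ⟨γ, rfl⟩ := surjective_mk c
  have hsub : γ.range ⊆ Aᶜ := by simpa using hc
  obtain ⟨δ, hδ, hthick⟩ :=
    γ.isCompact_range.exists_thickening_subset_open hA.isOpen_compl hsub
  refine ⟨δ, hδ, fun c' hc' ↦ ?_⟩
  obtain ⟨γ', rfl⟩ := surjective_mk c'
  rw [mk_mem_rangeSubset]
  intro t
  apply hthick
  rw [Metric.mem_thickening_iff]
  have h1 : Metric.infDist (γ' t) γ.range ≤ dist γ' γ := Curve.infDist_range_le γ' γ t
  have h2 : dist γ' γ < δ := by rwa [Metric.mem_ball, dist_mk_mk] at hc'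
  exact (Metric.infDist_lt_iff γ.range_nonempty).1 (h1.trans_lt h2)

/-- **Hitting a closed set `A` before a closed set `B` is a Borel event** in the space of curves
modulo reparametrisation: discharge of the named fact `measurableSet_hitsBefore`. For nonempty
`A, B` the event is `⋃ₙ ⋂ₘ` of images under the open quotient map `mk` of open sets of curves
(`hitsBefore_eq_iUnion_iInter`, `isOpen_hitsBeforeApprox`, `SeparationQuotient.isOpenMap_mk`); the
degenerate cases are `∅` and the closed event `hitsBefore A ∅`
(Aizenman–Burchard 1999, §2.1: measurability of crossing events). [folklore] -/
theorem measurableSet_hitsBefore_holds : measurableSet_hitsBefore (E := E) := by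
  intro A B hA hB
  rcases A.eq_empty_or_nonempty with rfl | hAne
  · rw [hitsBefore_empty_left]
    exact MeasurableSet.empty
  rcases B.eq_empty_or_nonempty with rfl | hBne
  · exact (isClosed_hitsBefore_empty_right hA).measurableSet
  rw [hitsBefore_eq_iUnion_iInter hA hB hAne hBne]
  refine MeasurableSet.iUnion fun n ↦ MeasurableSet.iInter fun m ↦ IsOpen.measurableSet ?_
  rw [mk_eq_separationQuotientMk]
  exact SeparationQuotient.isOpenMap_mk _ (isOpen_hitsBeforeApprox _ _ _ _)

end HitsBeforeMeasurable

end CurveClass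

end Literature.Probability.RandomPlanarGeometry
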